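import Summits.ValiantsHypothesis.ValiantsHypothesis.Theorems.LacunarySymmetroidMatrixDescartesCensusPivotDefs

/-!
# `MatrixDescartes` census — pivot column: R1₂ PROVED (a `2 × 2` pivot pencil with `K` PSD letters has `Z₊ ≤ 2K + 2`)

HONEST FRAMING.  Object-search cell `pub-symmetroid`, Conjecture-B column in pivot currency (`…CensusPivotDefs.lean`); seat
conjb-1 g0 (author of the proof; HOME file `pub-symmetroid-conjb-1/PivotTwoDescartes.lean`, farm rc 0, 2026-08-25), moved onto
the tree's shared `Pivot` vocabulary by the typer g8 (the verbatim local copies of the definitions are replaced by the import; the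
mathematics is conjb-1's).  THE THEOREM (R1₂ of the column, upper half): for `F = X^e • J + ∑ₖ X^{dₖ} • Pₖ` with `J` ANY real
symmetric `2 × 2` matrix and `Pₖ ⪰ 0`, the coefficient of `Xⁿ` in `det F` can be negative only for `n ∈ {2e} ∪ {e + dₖ}` (all
other coefficients are sums of mixed discriminants `a d′ + a′ d − 2 b b′ ≥ 0` of PSD pairs), so `det F` has at most `2(K+1)`
sign variations and Descartes' rule of signs (Mathlib `Polynomial.roots_countP_pos_le_signVariations`) bounds the distinct
positive roots by `2K + 2` — for EVERY pivot index (`pivotRootLawAt_two : PivotRootLawAt 2 K q (2K+2)`,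
`rankOnePivotLawTwo_holds : RankOnePivotLawTwo`).  Lower side of record: `2K − 3` attained for `K = 4, 5, 6`
(`…CensusPivotRankOne.lean`, `…CensusPivotStaircaseK5/K6.lean`), so the `m = 2`, index-1 law is pinned to
`2K − 3 ≤ ζ_piv(2,K,1) ≤ 2K + 2`.
Local vocabulary of the proof (this file only): `negSupp P` (indices of negative coefficients), `letter`/`expo` (the pencil
re-indexed by `Option (Fin K)`, `none ↦` the pivot), `agg` (the aggregated letter at a given degree).
Landed as a HELPER of the crux item stmt-ValiantsHypothesis-18050 with no closure claim; a theorem about `2 × 2` pivot pencils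
only — nothing here bears on `Theses.LacunarySymmetroid.MatrixDescartes`, on `KPlusLogSqLaw`, on the census registers, or on
`VP ≠ VNP`.

[folklore] Descartes' rule of signs (Mathlib), mixed discriminants of PSD `2 × 2` matrices; no single source.
-/

-- `Summit.ValiantsHypothesis.ValiantsHypothesis.…` repeats a component by the D-0017 layout
-- (single-conjunct summit), which the `dupNamespace` linter flags; the name is mandated.
set_option linter.dupNamespace false

namespace Summit.ValiantsHypothesis.ValiantsHypothesis.Theorems.LacunarySymmetroidMatrixDescartes.Pivot.TwoDescartes

open Polynomial Matrix Finset
open scoped BigOperators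

/-! ## 1. Sign variations are at most twice the number of negative coefficients -/

section SignVar

/-- the set of indices with negative coefficient -/
noncomputable def negSupp (P : ℝ[X]) : Finset ℕ := P.support.filter (fun n => P.coeff n < 0)

/-- Erasing the leading term removes its index from the negative support (and keeps the rest). [folklore] -/
theorem negSupp_eraseLead_subset (P : ℝ[X]) : negSupp P.eraseLead ⊆ (negSupp P).erase P.natDegree := by
  intro n hn
  simp only [negSupp, Finset.mem_filter, Polynomial.eraseLead_support, Finset.mem_erase] at hn ⊢
  obtain ⟨⟨hne, hmem⟩, hneg⟩ := hn
  refine ⟨hne, hmem, ?_⟩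
  rwa [Polynomial.eraseLead_coeff_of_ne n hne] at hneg

/-- Counting form of `negSupp_eraseLead_subset`: `#negSupp (eraseLead P) + [lc P < 0] ≤ #negSupp P`. [folklore] -/
theorem card_negSupp_eraseLead_add (P : ℝ[X]) (hP : P ≠ 0) :
    (negSupp P.eraseLead).card + (if P.leadingCoeff < 0 then 1 else 0) ≤ (negSupp P).card := by
  have hsub := negSupp_eraseLead_subset P
  split_ifs with hlc
  · have hmem : P.natDegree ∈ negSupp P := by
      simp only [negSupp, Finset.mem_filter, Polynomial.mem_support_iff]
      exact ⟨fun h => hP (Polynomial.leadingCoeff_eq_zero.mp h), hlc⟩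
    have h1 := Finset.card_le_card hsub
    rw [Finset.card_erase_of_mem hmem] at h1
    have h2 : 0 < (negSupp P).card := Finset.card_pos.mpr ⟨_, hmem⟩
    omega
  · have h1 := Finset.card_le_card (hsub.trans (Finset.erase_subset _ _))
    omega

/-- `signVariations P + [leadingCoeff P < 0] ≤ 2 · #negSupp P`. -/
theorem signVariations_add_le_two_mul_card_negSupp (P : ℝ[X]) :
    P.signVariations + (if P.leadingCoeff < 0 then 1 else 0) ≤ 2 * (negSupp P).card := by
  suffices h : ∀ N : ℕ, ∀ P : ℝ[X], P.support.card ≤ N →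
      P.signVariations + (if P.leadingCoeff < 0 then 1 else 0) ≤ 2 * (negSupp P).card from h _ P le_rfl
  intro N
  induction N with
  | zero =>
    intro P hP
    have hP0 : P = 0 := by
      have : P.support = ∅ := Finset.card_eq_zero.mp (Nat.le_zero.mp hP)
      exact Polynomial.support_eq_empty.mp this
    subst hP0
    simp
  | succ N ih =>
    intro P hP
    by_cases hP0 : P = 0
    · subst hP0; simp
    have hlt := Polynomial.eraseLead_support_card_lt hP0
    have ihP := ih P.eraseLead (by omega)
    have hcount := card_negSupp_eraseLead_add P hP0
    rw [Polynomial.signVariations_eq_eraseLead_add_ite hP0]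
    have hlc : P.leadingCoeff ≠ 0 := fun h => hP0 (Polynomial.leadingCoeff_eq_zero.mp h)
    -- if the two leading signs are opposite, one of the two leading coefficients is negative
    have key : SignType.sign P.leadingCoeff = -SignType.sign P.eraseLead.leadingCoeff →
        P.leadingCoeff < 0 ∨ P.eraseLead.leadingCoeff < 0 := by
      intro hs
      rcases lt_or_gt_of_ne hlc with h | h
      · exact Or.inl h
      · right
        rw [sign_pos h] at hs
        rcases lt_trichotomy P.eraseLead.leadingCoeff 0 with h' | h' | h'
        · exact h'
        · rw [h', sign_zero] at hs; exact absurd hs (by decide)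
        · rw [sign_pos h'] at hs; exact absurd hs (by decide)
    by_cases hs : SignType.sign P.leadingCoeff = -SignType.sign P.eraseLead.leadingCoeff
    · rw [if_pos hs]
      rcases key hs with h | h
      · rw [if_pos h] at hcount ⊢
        by_cases h' : P.eraseLead.leadingCoeff < 0
        · rw [if_pos h'] at ihP; omega
        · rw [if_neg h'] at ihP; omega
      · rw [if_pos h] at ihP
        by_cases h' : P.leadingCoeff < 0
        · rw [if_pos h'] at hcount ⊢; omega
        · rw [if_neg h'] at hcount ⊢; omega
    · rw [if_neg hs]
      by_cases h' : P.leadingCoeff < 0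
      · rw [if_pos h'] at hcount ⊢
        by_cases h'' : P.eraseLead.leadingCoeff < 0
        · rw [if_pos h''] at ihP; omega
        · rw [if_neg h''] at ihP; omega
      · rw [if_neg h'] at hcount ⊢
        by_cases h'' : P.eraseLead.leadingCoeff < 0
        · rw [if_pos h''] at ihP; omega
        · rw [if_neg h''] at ihP; omega

/-- **Descartes with a negative-support budget**: if every negative coefficient of `P` sits in `T`, then `P` has at
most `2 · #T` distinct positive roots. -/
theorem card_posRoots_le_two_mul_card (P : ℝ[X]) (T : Finset ℕ) (hT : ∀ n, P.coeff n < 0 → n ∈ T) :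
    (P.roots.toFinset.filter (fun t => 0 < t)).card ≤ 2 * T.card := by
  have h1 : (P.roots.toFinset.filter (fun t => 0 < t)).card ≤ P.roots.countP (fun t => 0 < t) := by
    rw [← Multiset.toFinset_filter, Multiset.countP_eq_card_filter]
    exact Multiset.toFinset_card_le _
  have h2 := P.roots_countP_pos_le_signVariations
  have h3 := signVariations_add_le_two_mul_card_negSupp P
  have h4 : (negSupp P).card ≤ T.card := by
    refine Finset.card_le_card ?_
    intro n hn
    simp only [negSupp, Finset.mem_filter] at hn
    exact hT n hn.2
  have : P.signVariations ≤ 2 * (negSupp P).card := le_trans (Nat.le_add_right _ _) h3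
  omega

end SignVar

/-! ## 2. Mixed discriminants of PSD `2 × 2` matrices -/

section TwoByTwo

/-- `a d' + a' d ≥ 2 b b'` for PSD triples `(a,b,d)`, `(a',b',d')`. -/
theorem mixedDisc_nonneg (a b d a' b' d' : ℝ) (ha : 0 ≤ a) (hd : 0 ≤ d) (ha' : 0 ≤ a') (hd' : 0 ≤ d')
    (h1 : b * b ≤ a * d) (h2 : b' * b' ≤ a' * d') : 0 ≤ a * d' + a' * d - 2 * (b * b') := by
  have hprod : b * b * (b' * b') ≤ a * d * (a' * d') :=
    mul_le_mul h1 h2 (mul_self_nonneg _) (mul_nonneg ha hd)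
  have hS : 0 ≤ a * d' + a' * d := by positivity
  have hsq : (2 * (b * b')) ^ 2 ≤ (a * d' + a' * d) ^ 2 := by nlinarith [sq_nonneg (a * d' - a' * d)]
  by_contra hneg
  have hneg' : a * d' + a' * d - 2 * (b * b') < 0 := lt_of_not_ge hneg
  have hT : 0 < 2 * (b * b') := by linarith
  nlinarith

/-- The three scalar facts about a PSD real `2 × 2` matrix used below. -/
theorem psd_two_facts {M : Matrix (Fin 2) (Fin 2) ℝ} (hM : M.PosSemidef) :
    0 ≤ M 0 0 ∧ 0 ≤ M 1 1 ∧ M 1 0 = M 0 1 ∧ M 0 1 * M 0 1 ≤ M 0 0 * M 1 1 := by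
  have hsym : M 1 0 = M 0 1 := by
    have h := hM.1.apply 0 1
    simpa using h
  have h00 : 0 ≤ M 0 0 := by
    have h := hM.dotProduct_mulVec_nonneg ![1, 0]
    simpa [Matrix.mulVec, dotProduct, Fin.sum_univ_two] using h
  have h11 : 0 ≤ M 1 1 := by
    have h := hM.dotProduct_mulVec_nonneg ![0, 1]
    simpa [Matrix.mulVec, dotProduct, Fin.sum_univ_two] using h
  have hdet : 0 ≤ M.det := hM.det_nonneg
  rw [Matrix.det_fin_two, hsym] at hdet
  exact ⟨h00, h11, hsym, by linarith⟩

end TwoByTwo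

/-! ## 3. The `2 × 2` pivot pencil: negative coefficients only at `e + e` and `e + dₖ` -/

section Pencil

variable {K : ℕ}

/-- letters indexed by `Option (Fin K)`: `none ↦ J` (the pivot), `some k ↦ P k`. -/
def letter (J : Matrix (Fin 2) (Fin 2) ℝ) (P : Fin K → Matrix (Fin 2) (Fin 2) ℝ) :
    Option (Fin K) → Matrix (Fin 2) (Fin 2) ℝ
  | none => J
  | some k => P k

/-- exponents indexed the same way. -/
def expo (e : ℕ) (d : Fin K → ℕ) : Option (Fin K) → ℕ
  | none => e
  | some k => d k

/-- the pencil as one sum over `Option (Fin K)`. -/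
theorem pencil_eq_sum (e : ℕ) (d : Fin K → ℕ) (J : Matrix (Fin 2) (Fin 2) ℝ) (P : Fin K → Matrix (Fin 2) (Fin 2) ℝ) :
    ((X : ℝ[X]) ^ e) • J.map Polynomial.C + ∑ k, ((X : ℝ[X]) ^ d k) • (P k).map Polynomial.C
      = ∑ l, ((X : ℝ[X]) ^ expo e d l) • (letter J P l).map Polynomial.C := by
  rw [Fintype.sum_option]
  rfl

/-- aggregated letter at degree `a`. -/
noncomputable def agg (e : ℕ) (d : Fin K → ℕ) (J : Matrix (Fin 2) (Fin 2) ℝ) (P : Fin K → Matrix (Fin 2) (Fin 2) ℝ)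
    (a : ℕ) : Matrix (Fin 2) (Fin 2) ℝ :=
  ∑ l, if expo e d l = a then letter J P l else 0

/-- The coefficient of `X^a` in an entry of the re-indexed pencil is the corresponding entry of `agg … a`. [folklore] -/
theorem coeff_entry (e : ℕ) (d : Fin K → ℕ) (J : Matrix (Fin 2) (Fin 2) ℝ) (P : Fin K → Matrix (Fin 2) (Fin 2) ℝ)
    (i j : Fin 2) (a : ℕ) :
    ((∑ l, ((X : ℝ[X]) ^ expo e d l) • (letter J P l).map Polynomial.C) i j).coeff a = agg e d J P a i j := by
  simp only [agg, Matrix.sum_apply, Matrix.smul_apply, Matrix.map_apply, smul_eq_mul, Polynomial.finsetSum_coeff]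
  refine Finset.sum_congr rfl fun l _ => ?_
  rw [mul_comm, Polynomial.coeff_C_mul_X_pow]
  split_ifs with h1 h2 h2
  · rfl
  · exact absurd h1.symm h2
  · exact absurd h2.symm h1
  · simp

/-- the coefficient of `Xⁿ` in `det` of the pencil. -/
theorem coeff_det (e : ℕ) (d : Fin K → ℕ) (J : Matrix (Fin 2) (Fin 2) ℝ) (P : Fin K → Matrix (Fin 2) (Fin 2) ℝ)
    (n : ℕ) :
    (Matrix.det (∑ l, ((X : ℝ[X]) ^ expo e d l) • (letter J P l).map Polynomial.C)).coeff n
      = ∑ x ∈ antidiagonal n,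
          (agg e d J P x.1 0 0 * agg e d J P x.2 1 1 - agg e d J P x.1 0 1 * agg e d J P x.2 1 0) := by
  rw [Matrix.det_fin_two, Polynomial.coeff_sub, Polynomial.coeff_mul, Polynomial.coeff_mul,
    ← Finset.sum_sub_distrib]
  refine Finset.sum_congr rfl fun x _ => ?_
  rw [coeff_entry, coeff_entry, coeff_entry, coeff_entry]

/-- if no letter has exponent `b`, the aggregated letter at `b` vanishes. -/
theorem agg_eq_zero (e : ℕ) (d : Fin K → ℕ) (J : Matrix (Fin 2) (Fin 2) ℝ) (P : Fin K → Matrix (Fin 2) (Fin 2) ℝ)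
    (b : ℕ) (hb : ∀ l, expo e d l ≠ b) : agg e d J P b = 0 := by
  unfold agg
  exact Finset.sum_eq_zero fun l _ => if_neg (hb l)

/-- away from the pivot exponent the aggregated letter is PSD. -/
theorem agg_posSemidef (e : ℕ) (d : Fin K → ℕ) (J : Matrix (Fin 2) (Fin 2) ℝ) (P : Fin K → Matrix (Fin 2) (Fin 2) ℝ)
    (hP : ∀ k, (P k).PosSemidef) (a : ℕ) (ha : a ≠ e) : (agg e d J P a).PosSemidef := by
  unfold agg
  refine Matrix.posSemidef_sum _ fun l _ => ?_
  rcases l with _ | k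
  · simp only [expo]
    rw [if_neg (Ne.symm ha)]
    exact Matrix.PosSemidef.zero
  · simp only [expo, letter]
    split_ifs
    · exact hP k
    · exact Matrix.PosSemidef.zero

/-- **Key sign lemma**: a negative coefficient of `det F` sits at `e + expo l` for some letter `l`. -/
theorem coeff_det_nonneg_of_not_mem (e : ℕ) (d : Fin K → ℕ) (J : Matrix (Fin 2) (Fin 2) ℝ)
    (P : Fin K → Matrix (Fin 2) (Fin 2) ℝ) (hP : ∀ k, (P k).PosSemidef) (n : ℕ)
    (hn : ∀ l, e + expo e d l ≠ n) :
    0 ≤ (Matrix.det (∑ l, ((X : ℝ[X]) ^ expo e d l) • (letter J P l).map Polynomial.C)).coeff n := by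
  rw [coeff_det]
  set g : ℕ × ℕ → ℝ := fun x =>
    agg e d J P x.1 0 0 * agg e d J P x.2 1 1 - agg e d J P x.1 0 1 * agg e d J P x.2 1 0 with hg
  -- symmetrise over the swap involution of the antidiagonal
  have hswap : ∑ x ∈ antidiagonal n, g x.swap = ∑ x ∈ antidiagonal n, g x :=
    Finset.Nat.sum_antidiagonal_swap
  have h2 : 2 * ∑ x ∈ antidiagonal n, g x = ∑ x ∈ antidiagonal n, (g x + g x.swap) := by
    rw [Finset.sum_add_distrib, hswap, two_mul]
  suffices hpair : ∀ x ∈ antidiagonal n, 0 ≤ g x + g x.swap by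
    have := Finset.sum_nonneg hpair
    change 0 ≤ ∑ x ∈ antidiagonal n, g x
    linarith
  intro x hx
  obtain ⟨a, b⟩ := x
  replace hx : a + b = n := by simpa using hx
  simp only [hg, Prod.swap_prod_mk]
  by_cases hae : a = e
  · -- then no letter has exponent b
    have hb : ∀ l, expo e d l ≠ b := by
      intro l hl; exact hn l (by rw [hl, ← hx, hae])
    rw [agg_eq_zero e d J P b hb]
    simp
  by_cases hbe : b = e
  · have ha : ∀ l, expo e d l ≠ a := by
      intro l hl; exact hn l (by rw [hl, ← hx, hbe, add_comm])
    rw [agg_eq_zero e d J P a ha]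
    simp
  obtain ⟨hA0, hA1, hAs, hAd⟩ := psd_two_facts (agg_posSemidef e d J P hP a hae)
  obtain ⟨hB0, hB1, hBs, hBd⟩ := psd_two_facts (agg_posSemidef e d J P hP b hbe)
  rw [hAs, hBs]
  have := mixedDisc_nonneg _ _ _ _ _ _ hA0 hA1 hB0 hB1 hAd hBd
  linarith

/-- **R1₂, upper half**: a `2 × 2` pencil `X^e J + ∑ X^{dₖ} Pₖ` with `J` symmetric (any index) and `Pₖ ⪰ 0`
has at most `2K + 2` distinct positive roots. -/
theorem pivotTwo_posRoots_le (e : ℕ) (d : Fin K → ℕ) (J : Matrix (Fin 2) (Fin 2) ℝ)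
    (P : Fin K → Matrix (Fin 2) (Fin 2) ℝ) (hP : ∀ k, (P k).PosSemidef) :
    ((Matrix.det (((X : ℝ[X]) ^ e) • J.map Polynomial.C
        + ∑ k, ((X : ℝ[X]) ^ d k) • (P k).map Polynomial.C)).roots.toFinset.filter (fun t => 0 < t)).card
      ≤ 2 * K + 2 := by
  classical
  rw [pencil_eq_sum]
  let T : Finset ℕ := Finset.univ.image (fun l : Option (Fin K) => e + expo e d l)
  have hT : T.card ≤ K + 1 := by
    refine le_trans Finset.card_image_le ?_
    simp [Fintype.card_option]
  have hneg : ∀ n, (Matrix.det (∑ l, ((X : ℝ[X]) ^ expo e d l) • (letter J P l).map Polynomial.C)).coeff n < 0 →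
      n ∈ T := by
    intro n hn
    by_contra hnot
    have hn' : ∀ l, e + expo e d l ≠ n := by
      intro l hl
      exact hnot (Finset.mem_image.mpr ⟨l, Finset.mem_univ _, hl⟩)
    exact absurd hn (not_lt.mpr (coeff_det_nonneg_of_not_mem e d J P hP n hn'))
  have := card_posRoots_le_two_mul_card _ T hneg
  omega

end Pencil

end Summit.ValiantsHypothesis.ValiantsHypothesis.Theorems.LacunarySymmetroidMatrixDescartes.Pivot.TwoDescartes

namespace Summit.ValiantsHypothesis.ValiantsHypothesis.Theorems.LacunarySymmetroidMatrixDescartes.Pivot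

/-- **R1₂ (upper half) holds — in fact for every index `q`** (the index hypothesis is not used at `m = 2`):
`PivotRootLawAt 2 K q (2K + 2)`. (conjb-1 g0) -/
theorem pivotRootLawAt_two (K q : ℕ) : PivotRootLawAt 2 K q (2 * K + 2) := by
  intro e d J P _hJ hP _hW
  exact TwoDescartes.pivotTwo_posRoots_le e d J P hP

/-- **`RankOnePivotLawTwo` holds**: a `2 × 2` pivot pencil of index `1` with `K` PSD letters has `Z₊ ≤ 2K + 2`. (conjb-1 g0) -/
theorem rankOnePivotLawTwo_holds : RankOnePivotLawTwo := fun K => pivotRootLawAt_two K 1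

end Summit.ValiantsHypothesis.ValiantsHypothesis.Theorems.LacunarySymmetroidMatrixDescartes.Pivot
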